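import Literature.AlgebraicGeometry.Motives.AbelianVarietyEndGaloisFinite
import Literature.AlgebraicGeometry.Motives.TateAbelianFiniteIsogenyClassProofs
import Literature.AlgebraicGeometry.Motives.AbelianVarietyPoincareCompleteReducibility
import Literature.AlgebraicGeometry.Motives.CechComplexPseudoCoherentGeneralProofs
import HarnessLib

/-!
# Tate's Main Theorem over a finite field from finiteness of isomorphism classes ALONE

J. Tate, *Endomorphisms of abelian varieties over finite fields*, Invent. Math. 2 (1966), Main
Theorem (the named facts `tate_bijective_of_finite A B ℓ`, `tate_end_bijective_of_finite A ℓ` of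
`Motives/TateAbelianFinite`). The assemblies of this directory prove it from three inputs: the
Theorem of the Cube, Poincaré's complete reducibility theorem over `K̄`, and a finiteness statement
for `K`-isomorphism classes (`Motives/AbelianVarietyEndGaloisFinite`,
`Motives/TateAbelianFiniteIsogenyClassProofs`). The first two are now theorems —
`cechComplex_pseudoCoherent_general_holds` (`Motives/CechComplexPseudoCoherentGeneralProofs`, giving
the cube) and `AbelianVariety.poincare_hP1` (`Motives/AbelianVarietyPoincareCompleteReducibility`,
Mumford §19 Thm. 1 over `K̄`) — so **the trust base of Tate's theorem over a finite field is reduced to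
the finiteness input alone**, in either of its two forms:

* `tate_bijective_of_finite_of_finite_isoClasses_of_finite`,
  `tate_end_bijective_of_finite_of_finite_isoClasses_of_finite` — from the named fact
  `finite_isoClasses_of_finite K (dim (A ⊞ B))` (Milne 1986, Cor. 18.9: finitely many
  `K`-isomorphism classes of abelian varieties of a given dimension over the finite field `K`;
  `Motives/TateAbelianFiniteLattice`);
* `tate_bijective_of_finite_of_exists_infinite_iso_alone`,
  `tate_end_bijective_of_finite_of_exists_infinite_iso_alone` — from Tate's own hypothesis (∞-iso)
  for the isogeny class of `A ⊞ B` only: in every sequence of abelian varieties over the finite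
  field `K` isogenous to `A ⊞ B`, infinitely many terms are mutually isomorphic (Tate 1966, §1,
  Hyp; Milne, *Abelian Varieties* (2008), Ch. IV, Lemma 2.4).

Hence `tate_bijective_of_finite_holds` will be
`tate_bijective_of_finite_of_finite_isoClasses_of_finite A B ℓ (finite_isoClasses_of_finite_holds K _)`
as soon as the latter lands. No named facts are introduced.

## References

* [Tate1966Endomorphisms] J. Tate, *Endomorphisms of abelian varieties over finite fields*,
  Invent. Math. 2 (1966), 134–144: Main Theorem; §1 (Hyp) and §2.
* [MilneAV2008] J. S. Milne, *Abelian Varieties* (v2.0, 2008), Ch. IV, Lemma 2.4 and Thm. 2.5.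
* [Milne1986AbelianVarieties] J. S. Milne, *Abelian Varieties*, in Cornell–Silverman (1986), Cor. 18.9.
* [MumfordAV1970] D. Mumford, *Abelian Varieties* (1970), §19 Thm. 1, App. I.
-/

noncomputable section

universe u

open CategoryTheory CategoryTheory.Limits AlgebraicGeometry

namespace Literature.AlgebraicGeometry.Motives

open AbelianVariety

variable {K : Type u} [Field K] (A B : AbelianVariety K) (ℓ : ℕ) [Fact ℓ.Prime]

/-- **Tate 1966, Main Theorem (`Hom` form) over a finite field, from `finite_isoClasses_of_finite`
alone**: the cube (`cechComplex_pseudoCoherent_general_holds`) and Poincaré reducibility over `K̄`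
(`AbelianVariety.poincare_hP1`) are theorems. [cite: Tate1966Endomorphisms, Main Theorem] -/
theorem tate_bijective_of_finite_of_finite_isoClasses_of_finite
    (hfin : finite_isoClasses_of_finite K (A ⊞ B).dim) : tate_bijective_of_finite A B ℓ :=
  tate_bijective_of_finite_of_pseudoCoherent_general_of_poincare_algebraicClosure A B ℓ
    cechComplex_pseudoCoherent_general_holds (poincare_hP1 (AlgebraicClosure K)) hfin

/-- **Tate 1966, Main Theorem (`End` form) over a finite field, from `finite_isoClasses_of_finite`
alone.** [cite: Tate1966Endomorphisms, Main Theorem] -/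
theorem tate_end_bijective_of_finite_of_finite_isoClasses_of_finite
    (hfin : finite_isoClasses_of_finite K (A ⊞ A).dim) : tate_end_bijective_of_finite A ℓ :=
  tate_end_bijective_of_finite_of_pseudoCoherent_general_of_poincare_algebraicClosure A ℓ
    cechComplex_pseudoCoherent_general_holds (poincare_hP1 (AlgebraicClosure K)) hfin

/-- **Tate 1966, Main Theorem (`Hom` form) over a finite field, from Tate's hypothesis (∞-iso) for
the isogeny class of `A ⊞ B` alone** (Tate 1966, §1, Hyp: in every sequence of abelian varieties
over `K` isogenous to `A ⊞ B` infinitely many terms are mutually `K`-isomorphic).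
[cite: Tate1966Endomorphisms, Main Theorem and §1] -/
theorem tate_bijective_of_finite_of_exists_infinite_iso_alone
    (hiso : ∀ [Finite K], ∀ C : ℕ → AbelianVariety K, (∀ n, IsIsogenous (C n) (A ⊞ B)) →
      ∃ S : Set ℕ, S.Infinite ∧ ∀ m ∈ S, ∀ n ∈ S, Nonempty (C m ≅ C n)) :
    tate_bijective_of_finite A B ℓ :=
  tate_bijective_of_finite_of_exists_infinite_iso_of_pseudoCoherent_general_of_poincare_algebraicClosure
    A B ℓ cechComplex_pseudoCoherent_general_holds (poincare_hP1 (AlgebraicClosure K)) hiso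

/-- **Tate 1966, Main Theorem (`End` form) over a finite field, from (∞-iso) for the isogeny class
of `A ⊞ A` alone.** [cite: Tate1966Endomorphisms, Main Theorem and §1] -/
theorem tate_end_bijective_of_finite_of_exists_infinite_iso_alone
    (hiso : ∀ [Finite K], ∀ C : ℕ → AbelianVariety K, (∀ n, IsIsogenous (C n) (A ⊞ A)) →
      ∃ S : Set ℕ, S.Infinite ∧ ∀ m ∈ S, ∀ n ∈ S, Nonempty (C m ≅ C n)) :
    tate_end_bijective_of_finite A ℓ :=
  tate_end_bijective_of_finite_of_exists_infinite_iso_of_pseudoCoherent_general_of_poincare_algebraicClosure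
    A ℓ cechComplex_pseudoCoherent_general_holds (poincare_hP1 (AlgebraicClosure K)) hiso

end Literature.AlgebraicGeometry.Motives
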